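import Literature.MathematicalPhysics.QuantumFieldTheory.Balaban1983to89.Node00.WilsonActionFirstVariation
import Literature.MathematicalPhysics.QuantumFieldTheory.Balaban1983to89.B10StarCount

/-!
# BalabanUVNodes ∕ N07 ([Balaban1985Variational] (5) p. 278, Sect. F p. 300; LOCATED-M5 certificate, part 22b) — A CONFIGURATION WHOSE BOND
# VARIABLES COMMUTE WITH ITS PLAQUETTE VARIABLES AND WHOSE FIELD STRENGTH IS `D` ON ONE COORDINATE PLANE AND `1` ELSEWHERE IS A CRITICAL
# CONFIGURATION OF THE WILSON ACTION (5) — unconstrained, hence on every fibre (`IsCritOnFibre`)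

Cell `pub-ymgap`, seat `pub-ymgap-dag-n07-e` generation 8 (R141 (C), DAG node N07 = [15]; ROW P11 negative lane, INBOX INTENT-22).
`--kind proof --supports stmt-QuantumFields-20293 --as helper`.  THEOREMS ONLY (0 `def`, 0 `sorry`).

WHAT THIS FILE DOES.  §1 (matrix algebra in `M_N(ℂ)`): under the tangent condition `X⋆U + U⋆X = 0` at a unitary `U`, the matrix `Y = X·U⋆` is skew-adjoint, so
`Re tr(X U⋆ G) + Re tr(X U⋆ G⋆) = 0` for every `G` (`re_trace_mul_star_add`), in particular `Re tr(X U⋆) = 0`.  §2: for a plaquette `p` with bonds `a, b, c, d` and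
holonomy `H = U_a U_b U_c⋆ U_d⋆`, if `U_a` and `U_d` commute with `H` then the real trace of this seat's four-term Leibniz derivative (21a `hasDerivAt_coe_plaqHol`) is
`f_a(H) + f_b(H) + f_c(H⋆) + f_d(H⋆)` with `f_b(G) = Re tr(X_b U_b⋆ G)` (`re_trace_leibniz_plaq`).  §3: hence for a configuration all of whose bond variables commute
with all plaquette variables and whose holonomy is `D` on the `(μ₀, ν₀)`-plaquettes and `1` on all others (part 22a's uniform flux), the first variation of (5)
against EVERY tangent family is `Σ_x [f_{⟨x,μ₀⟩}(D) + f_{⟨x,μ₀⟩}(D⋆)] + Σ_x [f_{⟨x,ν₀⟩}(D) + f_{⟨x,ν₀⟩}(D⋆)] = 0` after two translations of the torus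
(`firstVariation_eq_zero_of_planeFlux`), and ★ `isCritOnFibre_of_planeFlux`: such a configuration is `IsCritOnFibre F N K 𝐁 W U` for every determining set and
datum (21a `isCritOnFibre_of_firstVariation_eq_zero`) — an explicit NON-FLAT critical configuration of (5), the engine of this seat's LOCATED-M5 certificate (22c).

HONEST FRAMING: count-neutral kernel algebra; nothing of Bałaban asserted; N07 ∕ K0 NOT discharged (5∕27); one finite torus — NOT continuum ∕ ℝ⁴ ∕ OS ∕ mass gap ∕ Clay.

DEPENDENCES (by name): this seat's 21a `Node00.(coe_plaqHol_eq, isCritOnFibre_of_firstVariation_eq_zero)` (p525814), `Node00.IsCritOnFibre` (p514709),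
`B10StarCount.shiftEquiv`, Mathlib (`Matrix.trace_conjTranspose`, `Matrix.trace_mul_comm`, `Matrix.mem_unitaryGroup_iff(')`).
-/

noncomputable section

namespace Summit.QuantumFields.YangMills.BalabanUVNodes.N07UniformFluxCritical

open Literature.MathematicalPhysics.QuantumFieldTheory.Balaban1983to89
open Literature.MathematicalPhysics.QuantumFieldTheory.Balaban1983to89.T4Continuum (T4Family)
open Literature.MathematicalPhysics.QuantumFieldTheory.Balaban1983to89.Node00
open Literature.MathematicalPhysics.QuantumFieldTheory.Balaban1983to89.B15DeterminingSets

variable {N : ℕ}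

/-! ## §1  The tangent identity: `X U⋆` is skew-adjoint -/

section Tangent

variable {X u : Matrix (Fin N) (Fin N) ℂ}

/-- Under the tangent condition `X⋆U + U⋆X = 0` at a unitary `U`: `U X⋆ = −X U⋆`. [cite: Balaban1985Variational, (4) p.278 (the group; bookkeeping)] -/
theorem mul_star_eq_neg (h : star X * u + star u * X = 0) (hu : u * star u = 1) : u * star X = -(X * star u) := by
  have h1 : star X * u = -(star u * X) := eq_neg_of_add_eq_zero_left h
  calc u * star X = u * star X * (u * star u) := by rw [hu, mul_one]
    _ = u * (star X * u) * star u := by noncomm_ring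
    _ = -((u * star u) * X * star u) := by rw [h1]; noncomm_ring
    _ = -(X * star u) := by rw [hu, one_mul]

/-- Hence `Y = X U⋆` is skew-adjoint: `Y⋆ = −Y`. [cite: Balaban1985Variational, (4) p.278 (bookkeeping)] -/
theorem star_mul_star_eq_neg (h : star X * u + star u * X = 0) (hu : u * star u = 1) : star (X * star u) = -(X * star u) := by
  rw [star_mul, star_star, mul_star_eq_neg h hu]

/-- `Re tr M⋆ = Re tr M`. [folklore] -/
theorem re_trace_star (M : Matrix (Fin N) (Fin N) ℂ) : (Matrix.trace (star M)).re = (Matrix.trace M).re := by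
  rw [Matrix.star_eq_conjTranspose, Matrix.trace_conjTranspose, Complex.star_def, Complex.conj_re]

/-- ★ **THE TANGENT IDENTITY**: `Re tr(X U⋆ G) + Re tr(X U⋆ G⋆) = 0` for every matrix `G`, under the tangent condition at a unitary `U`.
[cite: Balaban1985Variational, (4)–(5) p.278 (bookkeeping)] -/
theorem re_trace_mul_star_add (h : star X * u + star u * X = 0) (hu : u * star u = 1) (G : Matrix (Fin N) (Fin N) ℂ) :
    (Matrix.trace (X * star u * G)).re + (Matrix.trace (X * star u * star G)).re = 0 := by
  have hY := star_mul_star_eq_neg h hu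
  rw [← re_trace_star (X * star u * star G), star_mul, star_star, hY, mul_neg, Matrix.trace_neg, Complex.neg_re,
    Matrix.trace_mul_comm G (X * star u)]
  ring

/-- In particular `Re tr(X U⋆) = 0`. [cite: Balaban1985Variational, (4)–(5) p.278 (bookkeeping)] -/
theorem re_trace_mul_star_eq_zero (h : star X * u + star u * X = 0) (hu : u * star u = 1) : (Matrix.trace (X * star u)).re = 0 := by
  have h1 := re_trace_mul_star_add h hu 1
  rw [star_one, mul_one] at h1
  linarith

end Tangent

/-! ## §2  The real trace of the four-term Leibniz derivative of one plaquette -/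

section Plaquette

variable {P : Params} {j : ℕ}

/-- A bond variable of an `SU(N)` configuration is unitary: `U U⋆ = 1`. [folklore] -/
theorem coe_mul_star_self (U : GaugeField P j (SU N)) (b : PBond P j) :
    ((U b : SU N) : Matrix (Fin N) (Fin N) ℂ) * star ((U b : SU N) : Matrix (Fin N) (Fin N) ℂ) = 1 :=
  Matrix.mem_unitaryGroup_iff.mp (U b).2.1

/-- A bond variable of an `SU(N)` configuration is unitary: `U⋆ U = 1`. [folklore] -/
theorem coe_star_mul_self (U : GaugeField P j (SU N)) (b : PBond P j) :
    star ((U b : SU N) : Matrix (Fin N) (Fin N) ℂ) * ((U b : SU N) : Matrix (Fin N) (Fin N) ℂ) = 1 :=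
  Matrix.mem_unitaryGroup_iff'.mp (U b).2.1

variable [NeZero N]

/-- ★ **THE REAL TRACE OF THE LEIBNIZ DERIVATIVE OF `U(∂p)`** along a tangent family `X`: if the first and the last bond variable of `p` commute with the
holonomy `H = U(∂p)`, it equals `f_a(H) + f_b(H) + f_c(H⋆) + f_d(H⋆)`, `f_b(G) = Re tr(X_b U_b⋆ G)`. [cite: Balaban1985Variational, (5) p.278, Sect. F p.300 (bookkeeping)] -/
theorem re_trace_leibniz_plaq (U : GaugeField P j (SU N)) (X : PBond P j → Matrix (Fin N) (Fin N) ℂ) (p : Plaq P j)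
    (hca : Commute (U ⟨p.src, p.μ⟩) (GaugeField.plaqHol U p)) (hcd : Commute (U ⟨p.src, p.ν⟩) (GaugeField.plaqHol U p)) :
    (Matrix.trace
      (X ⟨p.src, p.μ⟩ * (U ⟨p.src.shift p.μ, p.ν⟩ : Matrix (Fin N) (Fin N) ℂ) * star (U ⟨p.src.shift p.ν, p.μ⟩ : Matrix (Fin N) (Fin N) ℂ)
          * star (U ⟨p.src, p.ν⟩ : Matrix (Fin N) (Fin N) ℂ)
        + (U ⟨p.src, p.μ⟩ : Matrix (Fin N) (Fin N) ℂ) * X ⟨p.src.shift p.μ, p.ν⟩ * star (U ⟨p.src.shift p.ν, p.μ⟩ : Matrix (Fin N) (Fin N) ℂ)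
          * star (U ⟨p.src, p.ν⟩ : Matrix (Fin N) (Fin N) ℂ)
        + (U ⟨p.src, p.μ⟩ : Matrix (Fin N) (Fin N) ℂ) * (U ⟨p.src.shift p.μ, p.ν⟩ : Matrix (Fin N) (Fin N) ℂ) * star (X ⟨p.src.shift p.ν, p.μ⟩)
          * star (U ⟨p.src, p.ν⟩ : Matrix (Fin N) (Fin N) ℂ)
        + (U ⟨p.src, p.μ⟩ : Matrix (Fin N) (Fin N) ℂ) * (U ⟨p.src.shift p.μ, p.ν⟩ : Matrix (Fin N) (Fin N) ℂ)
          * star (U ⟨p.src.shift p.ν, p.μ⟩ : Matrix (Fin N) (Fin N) ℂ) * star (X ⟨p.src, p.ν⟩))).re =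
      (Matrix.trace (X ⟨p.src, p.μ⟩ * star (U ⟨p.src, p.μ⟩ : Matrix (Fin N) (Fin N) ℂ)
          * ((GaugeField.plaqHol U p : SU N) : Matrix (Fin N) (Fin N) ℂ))).re
      + (Matrix.trace (X ⟨p.src.shift p.μ, p.ν⟩ * star (U ⟨p.src.shift p.μ, p.ν⟩ : Matrix (Fin N) (Fin N) ℂ)
          * ((GaugeField.plaqHol U p : SU N) : Matrix (Fin N) (Fin N) ℂ))).re
      + (Matrix.trace (X ⟨p.src.shift p.ν, p.μ⟩ * star (U ⟨p.src.shift p.ν, p.μ⟩ : Matrix (Fin N) (Fin N) ℂ)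
          * star ((GaugeField.plaqHol U p : SU N) : Matrix (Fin N) (Fin N) ℂ))).re
      + (Matrix.trace (X ⟨p.src, p.ν⟩ * star (U ⟨p.src, p.ν⟩ : Matrix (Fin N) (Fin N) ℂ)
          * star ((GaugeField.plaqHol U p : SU N) : Matrix (Fin N) (Fin N) ℂ))).re := by
  -- opaque names for the four bond matrices and the holonomy
  obtain ⟨ua, hua⟩ : ∃ m : Matrix (Fin N) (Fin N) ℂ, ((U ⟨p.src, p.μ⟩ : SU N) : Matrix (Fin N) (Fin N) ℂ) = m := ⟨_, rfl⟩
  obtain ⟨ub, hub⟩ : ∃ m : Matrix (Fin N) (Fin N) ℂ, ((U ⟨p.src.shift p.μ, p.ν⟩ : SU N) : Matrix (Fin N) (Fin N) ℂ) = m := ⟨_, rfl⟩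
  obtain ⟨uc, huc⟩ : ∃ m : Matrix (Fin N) (Fin N) ℂ, ((U ⟨p.src.shift p.ν, p.μ⟩ : SU N) : Matrix (Fin N) (Fin N) ℂ) = m := ⟨_, rfl⟩
  obtain ⟨ud, hud⟩ : ∃ m : Matrix (Fin N) (Fin N) ℂ, ((U ⟨p.src, p.ν⟩ : SU N) : Matrix (Fin N) (Fin N) ℂ) = m := ⟨_, rfl⟩
  have hsa : star ua * ua = 1 := by rw [← hua]; exact coe_star_mul_self U ⟨p.src, p.μ⟩
  have hsb : star ub * ub = 1 := by rw [← hub]; exact coe_star_mul_self U ⟨p.src.shift p.μ, p.ν⟩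
  have hsc : star uc * uc = 1 := by rw [← huc]; exact coe_star_mul_self U ⟨p.src.shift p.ν, p.μ⟩
  have hsd : star ud * ud = 1 := by rw [← hud]; exact coe_star_mul_self U ⟨p.src, p.ν⟩
  -- the two commutations, as matrix identities
  have hca' : ((U ⟨p.src, p.μ⟩ : SU N) : Matrix (Fin N) (Fin N) ℂ) * ((GaugeField.plaqHol U p : SU N) : Matrix (Fin N) (Fin N) ℂ)
      = ((GaugeField.plaqHol U p : SU N) : Matrix (Fin N) (Fin N) ℂ) * ((U ⟨p.src, p.μ⟩ : SU N) : Matrix (Fin N) (Fin N) ℂ) :=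
    congrArg Subtype.val hca.eq
  have hcd' : ((U ⟨p.src, p.ν⟩ : SU N) : Matrix (Fin N) (Fin N) ℂ) * ((GaugeField.plaqHol U p : SU N) : Matrix (Fin N) (Fin N) ℂ)
      = ((GaugeField.plaqHol U p : SU N) : Matrix (Fin N) (Fin N) ℂ) * ((U ⟨p.src, p.ν⟩ : SU N) : Matrix (Fin N) (Fin N) ℂ) :=
    congrArg Subtype.val hcd.eq
  have hH : ((GaugeField.plaqHol U p : SU N) : Matrix (Fin N) (Fin N) ℂ) = ua * ub * star uc * star ud := by
    rw [coe_plaqHol_eq, hua, hub, huc, hud]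
  obtain ⟨H, hHm⟩ : ∃ m : Matrix (Fin N) (Fin N) ℂ, ((GaugeField.plaqHol U p : SU N) : Matrix (Fin N) (Fin N) ℂ) = m := ⟨_, rfl⟩
  rw [hua, hHm] at hca'
  rw [hud, hHm] at hcd'
  rw [hHm] at hH
  rw [hua, hub, huc, hud, hHm]
  -- `H = U_a⋆ H U_a` and `H⋆ = U_d⋆ H⋆ U_d`
  have hHa : H = star ua * H * ua := by
    calc H = star ua * ua * H := by rw [hsa, one_mul]
      _ = star ua * (ua * H) := by noncomm_ring
      _ = star ua * (H * ua) := by rw [hca']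
      _ = star ua * H * ua := by noncomm_ring
  have hHd : star H = star ud * star H * ud := by
    have h1 : star H * star ud = star ud * star H := by
      have h2 := congrArg star hcd'
      rw [star_mul, star_mul] at h2
      exact h2
    calc star H = star H * (star ud * ud) := by rw [hsd, mul_one]
      _ = star H * star ud * ud := by noncomm_ring
      _ = star ud * star H * ud := by rw [h1]
  have hstarH : star H = ud * uc * star ub * star ua := by
    rw [hH, star_mul, star_mul, star_mul, star_star, star_star]; noncomm_ring
  -- term 1: `X_a U_b U_c⋆ U_d⋆ = X_a U_a⋆ H`
  have h1 : X ⟨p.src, p.μ⟩ * ub * star uc * star ud = X ⟨p.src, p.μ⟩ * star ua * H := by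
    rw [hH]
    calc X ⟨p.src, p.μ⟩ * ub * star uc * star ud = X ⟨p.src, p.μ⟩ * (star ua * ua) * ub * star uc * star ud := by rw [hsa, mul_one]
      _ = X ⟨p.src, p.μ⟩ * star ua * (ua * ub * star uc * star ud) := by noncomm_ring
  -- term 2: `tr(U_a X_b U_c⋆ U_d⋆) = tr(X_b U_b⋆ H)`
  have h2 : Matrix.trace (ua * X ⟨p.src.shift p.μ, p.ν⟩ * star uc * star ud) = Matrix.trace (X ⟨p.src.shift p.μ, p.ν⟩ * star ub * H) := by
    have h21 : ua * X ⟨p.src.shift p.μ, p.ν⟩ * star uc * star ud = ua * (X ⟨p.src.shift p.μ, p.ν⟩ * star uc * star ud) := by noncomm_ring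
    have h22 : X ⟨p.src.shift p.μ, p.ν⟩ * star ub * H = X ⟨p.src.shift p.μ, p.ν⟩ * star uc * star ud * ua := by
      rw [hHa, hH]
      calc X ⟨p.src.shift p.μ, p.ν⟩ * star ub * (star ua * (ua * ub * star uc * star ud) * ua)
          = X ⟨p.src.shift p.μ, p.ν⟩ * (star ub * ((star ua * ua) * ub)) * star uc * star ud * ua := by noncomm_ring
        _ = X ⟨p.src.shift p.μ, p.ν⟩ * star uc * star ud * ua := by rw [hsa, one_mul, hsb, mul_one]
    rw [h21, Matrix.trace_mul_comm, h22]
  -- term 3: `Re tr(U_a U_b X_c⋆ U_d⋆) = Re tr(X_c U_c⋆ H⋆)`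
  have h3 : (Matrix.trace (ua * ub * star (X ⟨p.src.shift p.ν, p.μ⟩) * star ud)).re
      = (Matrix.trace (X ⟨p.src.shift p.ν, p.μ⟩ * star uc * star H)).re := by
    rw [← re_trace_star (ua * ub * star (X ⟨p.src.shift p.ν, p.μ⟩) * star ud), star_mul, star_mul, star_mul, star_star, star_star]
    have h31 : ud * (X ⟨p.src.shift p.ν, p.μ⟩ * (star ub * star ua)) = ud * (X ⟨p.src.shift p.ν, p.μ⟩ * star ub * star ua) := by
      noncomm_ring
    have h32 : X ⟨p.src.shift p.ν, p.μ⟩ * star uc * star H = X ⟨p.src.shift p.ν, p.μ⟩ * star ub * star ua * ud := by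
      rw [hHd, hstarH]
      calc X ⟨p.src.shift p.ν, p.μ⟩ * star uc * (star ud * (ud * uc * star ub * star ua) * ud)
          = X ⟨p.src.shift p.ν, p.μ⟩ * (star uc * ((star ud * ud) * uc)) * star ub * star ua * ud := by noncomm_ring
        _ = X ⟨p.src.shift p.ν, p.μ⟩ * star ub * star ua * ud := by rw [hsd, one_mul, hsc, mul_one]
    rw [h31, Matrix.trace_mul_comm, h32]
  -- term 4: `Re tr(U_a U_b U_c⋆ X_d⋆) = Re tr(X_d U_d⋆ H⋆)`
  have h4 : (Matrix.trace (ua * ub * star uc * star (X ⟨p.src, p.ν⟩))).re = (Matrix.trace (X ⟨p.src, p.ν⟩ * star ud * star H)).re := by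
    rw [← re_trace_star (ua * ub * star uc * star (X ⟨p.src, p.ν⟩)), star_mul, star_mul, star_mul, star_star, star_star, hstarH]
    have h41 : X ⟨p.src, p.ν⟩ * star ud * (ud * uc * star ub * star ua) = X ⟨p.src, p.ν⟩ * ((star ud * ud) * uc) * star ub * star ua := by
      noncomm_ring
    rw [h41, hsd, one_mul]
    congr 2
    noncomm_ring
  rw [Matrix.trace_add, Matrix.trace_add, Matrix.trace_add, Complex.add_re, Complex.add_re, Complex.add_re, h1, h2, h3, h4]

end Plaquette

/-! ## §3  Plane flux: the first variation vanishes; the configuration is critical on every fibre -/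

section PlaneFlux

variable [NeZero N] {P : Params} {j : ℕ}

/-- A sum over plaquettes of a quantity supported on the `(μ₀, ν₀)`-plaquettes is a sum over their base points. [folklore] -/
theorem sum_plaq_plane {R : Type*} [AddCommMonoid R] {μ0 ν0 : Fin P.d} (hμν : μ0 < ν0) (g : Site P j → R) :
    ∑ p : Plaq P j, (if p.μ = μ0 ∧ p.ν = ν0 then g p.src else 0) = ∑ x : Site P j, g x := by
  classical
  let emb : Site P j ↪ Plaq P j := ⟨fun x => ⟨x, μ0, ν0, hμν⟩, fun x y h => by cases h; rfl⟩
  have h1 : ∑ x : Site P j, g x = ∑ p ∈ (Finset.univ : Finset (Site P j)).map emb, (if p.μ = μ0 ∧ p.ν = ν0 then g p.src else 0) := by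
    rw [Finset.sum_map]
    refine Finset.sum_congr rfl fun x _ => ?_
    exact (if_pos (by exact ⟨rfl, rfl⟩)).symm
  rw [h1]
  symm
  refine Finset.sum_subset (Finset.subset_univ _) fun p _ hp => ?_
  refine if_neg fun hpl => hp ?_
  rw [Finset.mem_map]
  refine ⟨p.src, Finset.mem_univ _, ?_⟩
  obtain ⟨x, μ, ν, h⟩ := p
  obtain ⟨rfl, rfl⟩ := hpl
  rfl

/-- ★★ **THE FIRST VARIATION OF (5) VANISHES AT A PLANE-FLUX CONFIGURATION**: if every bond variable commutes with every plaquette variable and the holonomy is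
`D` on the `(μ₀, ν₀)`-plaquettes and `1` on all others, then `Σ_p Re tr(Leibniz derivative of U(∂p)) = 0` against EVERY tangent family `X` (`X_b⋆U_b + U_b⋆X_b = 0`).
[cite: Balaban1985Variational, (5) p.278, Sect. F p.300 («critical configurations of the functional (5)»)] -/
theorem firstVariation_eq_zero_of_planeFlux {μ0 ν0 : Fin P.d} (hμν : μ0 < ν0) {U : GaugeField P j (SU N)} {D : SU N}
    (hcomm : ∀ b p, Commute (U b) (GaugeField.plaqHol U p))
    (hH : ∀ p : Plaq P j, GaugeField.plaqHol U p = if p.μ = μ0 ∧ p.ν = ν0 then D else 1)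
    (X : PBond P j → Matrix (Fin N) (Fin N) ℂ)
    (hX : ∀ b, star (X b) * ((U b : SU N) : Matrix (Fin N) (Fin N) ℂ) + star ((U b : SU N) : Matrix (Fin N) (Fin N) ℂ) * X b = 0) :
    ∑ p : Plaq P j, ((Matrix.traceLinearMap (Fin N) ℝ ℂ)
        (X ⟨p.src, p.μ⟩ * (U ⟨p.src.shift p.μ, p.ν⟩ : Matrix (Fin N) (Fin N) ℂ) * star (U ⟨p.src.shift p.ν, p.μ⟩ : Matrix (Fin N) (Fin N) ℂ)
            * star (U ⟨p.src, p.ν⟩ : Matrix (Fin N) (Fin N) ℂ)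
          + (U ⟨p.src, p.μ⟩ : Matrix (Fin N) (Fin N) ℂ) * X ⟨p.src.shift p.μ, p.ν⟩ * star (U ⟨p.src.shift p.ν, p.μ⟩ : Matrix (Fin N) (Fin N) ℂ)
            * star (U ⟨p.src, p.ν⟩ : Matrix (Fin N) (Fin N) ℂ)
          + (U ⟨p.src, p.μ⟩ : Matrix (Fin N) (Fin N) ℂ) * (U ⟨p.src.shift p.μ, p.ν⟩ : Matrix (Fin N) (Fin N) ℂ) * star (X ⟨p.src.shift p.ν, p.μ⟩)
            * star (U ⟨p.src, p.ν⟩ : Matrix (Fin N) (Fin N) ℂ)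
          + (U ⟨p.src, p.μ⟩ : Matrix (Fin N) (Fin N) ℂ) * (U ⟨p.src.shift p.μ, p.ν⟩ : Matrix (Fin N) (Fin N) ℂ)
            * star (U ⟨p.src.shift p.ν, p.μ⟩ : Matrix (Fin N) (Fin N) ℂ) * star (X ⟨p.src, p.ν⟩))).re = 0 := by
  -- abbreviation (opaque): `f b G = Re tr(X_b U_b⋆ G)`; `d = ↑D`
  obtain ⟨f, hf⟩ : ∃ f : PBond P j → Matrix (Fin N) (Fin N) ℂ → ℝ,
      ∀ b G, (Matrix.trace (X b * star ((U b : SU N) : Matrix (Fin N) (Fin N) ℂ) * G)).re = f b G := ⟨_, fun _ _ => rfl⟩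
  have hfadd : ∀ b G, f b G + f b (star G) = 0 := fun b G => by
    rw [← hf, ← hf]; exact re_trace_mul_star_add (hX b) (coe_mul_star_self U b) G
  have hf1 : ∀ b, f b 1 = 0 := fun b => by
    rw [← hf, mul_one]; exact re_trace_mul_star_eq_zero (hX b) (coe_mul_star_self U b)
  obtain ⟨d, hd⟩ : ∃ m : Matrix (Fin N) (Fin N) ℂ, ((D : SU N) : Matrix (Fin N) (Fin N) ℂ) = m := ⟨_, rfl⟩
  -- Step 1: each plaquette term is `f_a(H) + f_b(H) + f_c(H⋆) + f_d(H⋆)`, supported on the plane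
  have hterm : ∀ p : Plaq P j, ((Matrix.traceLinearMap (Fin N) ℝ ℂ)
        (X ⟨p.src, p.μ⟩ * (U ⟨p.src.shift p.μ, p.ν⟩ : Matrix (Fin N) (Fin N) ℂ) * star (U ⟨p.src.shift p.ν, p.μ⟩ : Matrix (Fin N) (Fin N) ℂ)
            * star (U ⟨p.src, p.ν⟩ : Matrix (Fin N) (Fin N) ℂ)
          + (U ⟨p.src, p.μ⟩ : Matrix (Fin N) (Fin N) ℂ) * X ⟨p.src.shift p.μ, p.ν⟩ * star (U ⟨p.src.shift p.ν, p.μ⟩ : Matrix (Fin N) (Fin N) ℂ)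
            * star (U ⟨p.src, p.ν⟩ : Matrix (Fin N) (Fin N) ℂ)
          + (U ⟨p.src, p.μ⟩ : Matrix (Fin N) (Fin N) ℂ) * (U ⟨p.src.shift p.μ, p.ν⟩ : Matrix (Fin N) (Fin N) ℂ) * star (X ⟨p.src.shift p.ν, p.μ⟩)
            * star (U ⟨p.src, p.ν⟩ : Matrix (Fin N) (Fin N) ℂ)
          + (U ⟨p.src, p.μ⟩ : Matrix (Fin N) (Fin N) ℂ) * (U ⟨p.src.shift p.μ, p.ν⟩ : Matrix (Fin N) (Fin N) ℂ)
            * star (U ⟨p.src.shift p.ν, p.μ⟩ : Matrix (Fin N) (Fin N) ℂ) * star (X ⟨p.src, p.ν⟩))).re =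
      if p.μ = μ0 ∧ p.ν = ν0 then
        f ⟨p.src, μ0⟩ d + f ⟨p.src.shift μ0, ν0⟩ d + f ⟨p.src.shift ν0, μ0⟩ (star d) + f ⟨p.src, ν0⟩ (star d)
      else 0 := by
    intro p
    rw [Matrix.traceLinearMap_apply, re_trace_leibniz_plaq U X p (hcomm _ p) (hcomm _ p), hH p, hf, hf, hf, hf]
    split_ifs with hp
    · obtain ⟨hμ, hν⟩ := hp
      rw [← hμ, ← hν, hd]
    · rw [OneMemClass.coe_one, star_one, hf1, hf1, hf1, hf1]
      ring
  have hplane := sum_plaq_plane hμν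
    (fun x => f ⟨x, μ0⟩ d + f ⟨x.shift μ0, ν0⟩ d + f ⟨x.shift ν0, μ0⟩ (star d) + f ⟨x, ν0⟩ (star d))
  rw [Finset.sum_congr rfl fun p _ => hterm p, hplane]
  -- Step 2: translate two of the four sums
  have hs1 : ∑ x : Site P j, f ⟨x.shift μ0, ν0⟩ d = ∑ x : Site P j, f ⟨x, ν0⟩ d :=
    Fintype.sum_equiv (B10StarCount.shiftEquiv μ0) _ _ fun _ => rfl
  have hs2 : ∑ x : Site P j, f ⟨x.shift ν0, μ0⟩ (star d) = ∑ x : Site P j, f ⟨x, μ0⟩ (star d) :=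
    Fintype.sum_equiv (B10StarCount.shiftEquiv ν0) _ _ fun _ => rfl
  simp only [Finset.sum_add_distrib]
  rw [hs1, hs2]
  -- Step 3: the tangent identity bond by bond
  have hμsum : ∑ x : Site P j, f ⟨x, μ0⟩ d + ∑ x : Site P j, f ⟨x, μ0⟩ (star d) = 0 := by
    rw [← Finset.sum_add_distrib]; exact Finset.sum_eq_zero fun x _ => hfadd _ d
  have hνsum : ∑ x : Site P j, f ⟨x, ν0⟩ d + ∑ x : Site P j, f ⟨x, ν0⟩ (star d) = 0 := by
    rw [← Finset.sum_add_distrib]; exact Finset.sum_eq_zero fun x _ => hfadd _ d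
  linarith

end PlaneFlux

/-! ## §4  On the `T⁴` family: critical on every fibre -/

section Family

variable {F : T4Family} {N : ℕ} [NeZero N]

/-- ★★ **A PLANE-FLUX CONFIGURATION IS A CRITICAL CONFIGURATION OF (5) ON EVERY FIBRE** (`IsCritOnFibre F N K 𝐁 W U` for every determining set `𝐁` and
datum `W`): the first variation vanishes against every tangent family (§3), and this seat's criticality test (21a) applies.  With `D ≠ 1` the configuration is
NOT flat — a critical NON-minimiser of the Wilson action. [cite: Balaban1985Variational, (5) p.278, Sect. F p.300, Prop. 8 p.304 (the critical configurations)] -/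
theorem isCritOnFibre_of_planeFlux {K : ℕ} {μ0 ν0 : Fin (F.P K).d} (hμν : μ0 < ν0) {U : GaugeField (F.P K) 0 (SU N)} {D : SU N}
    (hcomm : ∀ b p, Commute (U b) (GaugeField.plaqHol U p))
    (hH : ∀ p : Plaq (F.P K) 0, GaugeField.plaqHol U p = if p.μ = μ0 ∧ p.ν = ν0 then D else 1)
    (𝔹 : DetSet (F.P K)) (W : MSField (F.P K) (SU N)) : IsCritOnFibre F N K 𝔹 W U :=
  isCritOnFibre_of_firstVariation_eq_zero (fun X hX => firstVariation_eq_zero_of_planeFlux hμν hcomm hH X hX) 𝔹 W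

end Family

end Summit.QuantumFields.YangMills.BalabanUVNodes.N07UniformFluxCritical

end
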